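import Literature.MathematicalPhysics.QuantumFieldTheory.Balaban1983to89.T4RateLiaison

/-!
# NE7EtaLiaisonAdapter — route #1 of the NE7 crux, stub S2 AS TYPED is EXACTLY «backgrounds close»: the pair
# (`T4EtaRateMin.LocalRate R C θ`, `T4RateLiaison.GaugeDominated R uA uB`) consumed by `T4TowerRateDischarge.uRateUpTo_of_nodes`
# is inhabited, for ANY carrier, by the CUMULATIVE-GAUGE READING as soon as `∀ K, ∀ v ∈ Adm, gauge (uA K v) (transport (uB K v)) ≤ Cθ^K`

Cell `pub-balaban`, rung (B)+1 sub-cell t4, lineage `b2b-balaban-t4-ne7-p1`, generation 21 (CRUX PROVER NE7 #1, ruling e34b3e0c); crux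
skeleton `t4/skeletons/NE7-CRUX-R1.md` v1.5.1 row S2 (after ERRATUM E-g21-1: the gen-20 tower-reading adapter is vacuous; reading (D) of
`NE3LocalCrudeWEnd` inhabits `LocalRate` but not `GaugeDominated`).  HONEST FRAMING (page 1): FIXED FINITE T⁴, rung (B)+1; NE7, NE3 NOT
PRINTED in [Balaban1984PropagatorsI]–[Balaban1989LargeFieldII] and NOT PROVED here; continuum YM on T⁴ ⇐ BetaPertH ∧ nine spine estimates
(0/9 proved); BetaPertH ⇐ (D1) ∧ (D4) ∧ CAP+tail; G-an2-4 gates asym, D1 and NE2/3/4; NOT infinite volume, NOT mass gap, NOT Clay.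

WHAT.  Route #1's composition of record (END p215546) reads stub S2 through `uRateUpTo_of_nodes`, whose binders are a family of scalar
READINGS `R` with `LocalRate R C₃ θ₃` AND the liaison `GaugeDominated R uA uB` («site discrepancies of the readings dominate the carriers'
gauge of the pair»), used only through `T4TowerRateDischarge.closeness_of_localRate` to obtain
`∀ K, ∀ v ∈ R.dom, gauge (uA K v) (transport (uB K v)) ≤ C₃θ₃^K`.  THIS FILE proves the converse bookkeeping: GIVEN that closeness
(`hclose`, the binder of `T4TowerRateComposition.uRateUpTo_tower`), the readings
`R := ⟨Adm, 0, (K, v, _) ↦ Σ_{j<K} gauge (uA j v) (transport (uB j v)), 0⟩` (site type `PUnit`; the CUMULATIVE GAUGE along the tower)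
satisfy BOTH `LocalRate R C₃ θ₃` (`localRate_cumGauge`) and `GaugeDominated R uA uB` (`gaugeDominated_cumGauge`), and
`closeness_of_localRate` returns `hclose` (`closeness_roundtrip`).  So S2 AS TYPED ≡ «backgrounds close at rate `C₃θ₃^K` on the admissible
data» — nothing more, nothing less; the gen-21 junction files (`NE7EtaSupFromEnergyTorus`, `NE7EtaGradientFromEnergy`,
`NE7EtaPlaquetteClosenessTorus`) deliver exactly that closeness, coordinate by coordinate in the (1.13) currency, CONDITIONAL on row NE3's
re-typed root and NODE O's carrier — and can therefore feed the END of record WITHOUT any change to it.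
HONEST.  Pure bookkeeping over the abstract carrier ([folklore]); no carrier is instantiated (NODE O); nothing of NE3∕NE7 asserted; 0 def,
0 sorry.
-/

namespace Summit.QuantumFields.BalabanUV.T4Continuum.NE7EtaLiaisonAdapter

open Finset
open Literature.MathematicalPhysics.QuantumFieldTheory.Balaban1983to89
open T4EtaRateMin (Readings LocalRate)
open T4OutputRate (Carriers)
open T4RateLiaison (GaugeDominated)

variable {ι : Type} {Car : Carriers}

/-- The consecutive difference of the cumulative gauge is the gauge at the last level. [folklore] -/
theorem cumGauge_succ_sub (uA : ℕ → ι → Car.BgA) (uB : ℕ → ι → Car.BgB) (K : ℕ) (v : ι) :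
    (∑ j ∈ Finset.range (K + 1), Car.gauge (uA j v) (Car.transport (uB j v)))
        - ∑ j ∈ Finset.range K, Car.gauge (uA j v) (Car.transport (uB j v))
      = Car.gauge (uA K v) (Car.transport (uB K v)) := by
  rw [Finset.sum_range_succ]; ring

/-- **`LocalRate` OF THE CUMULATIVE-GAUGE READING from closeness**: `hclose : ∀ K, ∀ v ∈ Adm, gauge ≤ Cθ^K` ⇒
`LocalRate ⟨Adm, 0, cumulative gauge, 0⟩ C θ`. [folklore] -/
theorem localRate_cumGauge (Adm : Set ι) (uA : ℕ → ι → Car.BgA) (uB : ℕ → ι → Car.BgB) {C θ : ℝ}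
    (hclose : ∀ K : ℕ, ∀ v ∈ Adm, Car.gauge (uA K v) (Car.transport (uB K v)) ≤ C * θ ^ K) :
    LocalRate (⟨Adm, fun _ _ => 0, fun K v (_ : PUnit) => ∑ j ∈ Finset.range K, Car.gauge (uA j v) (Car.transport (uB j v)),
      0, le_rfl⟩ : Readings ι PUnit) C θ := by
  intro K v hv _
  change |(∑ j ∈ Finset.range (K + 1), Car.gauge (uA j v) (Car.transport (uB j v)))
      - ∑ j ∈ Finset.range K, Car.gauge (uA j v) (Car.transport (uB j v))| ≤ C * θ ^ K
  rw [cumGauge_succ_sub, abs_of_nonneg (Car.gauge_nonneg _ _)]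
  exact hclose K v hv

/-- **`GaugeDominated` OF THE CUMULATIVE-GAUGE READING** (for ANY realisation `uA, uB`, no hypothesis): the unique site discrepancy IS the
gauge. [folklore] -/
theorem gaugeDominated_cumGauge (Adm : Set ι) (uA : ℕ → ι → Car.BgA) (uB : ℕ → ι → Car.BgB) :
    GaugeDominated (⟨Adm, fun _ _ => 0, fun K v (_ : PUnit) => ∑ j ∈ Finset.range K, Car.gauge (uA j v) (Car.transport (uB j v)),
      0, le_rfl⟩ : Readings ι PUnit) uA uB := by
  intro K v _ M hM
  have h := hM PUnit.unit
  change |(∑ j ∈ Finset.range (K + 1), Car.gauge (uA j v) (Car.transport (uB j v)))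
      - ∑ j ∈ Finset.range K, Car.gauge (uA j v) (Car.transport (uB j v))| ≤ M at h
  rw [cumGauge_succ_sub, abs_of_nonneg (Car.gauge_nonneg _ _)] at h
  exact h

/-- **ROUND TRIP**: with these readings, route #1's seam `T4TowerRateDischarge.closeness_of_localRate` (= `T4RateLiaison.gauge_le_of_localRate`)
returns exactly the closeness one started from — S2 AS TYPED is «backgrounds close at rate `Cθ^K`», no more, no less. [folklore] -/
theorem closeness_roundtrip (Adm : Set ι) (uA : ℕ → ι → Car.BgA) (uB : ℕ → ι → Car.BgB) {C θ : ℝ}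
    (hclose : ∀ K : ℕ, ∀ v ∈ Adm, Car.gauge (uA K v) (Car.transport (uB K v)) ≤ C * θ ^ K) :
    ∀ K : ℕ, ∀ v ∈ Adm, Car.gauge (uA K v) (Car.transport (uB K v)) ≤ C * θ ^ K :=
  fun K _ hv =>
    T4RateLiaison.gauge_le_of_localRate (localRate_cumGauge Adm uA uB hclose) (gaugeDominated_cumGauge Adm uA uB) K hv

end Summit.QuantumFields.BalabanUV.T4Continuum.NE7EtaLiaisonAdapter
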